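import Summits.HodgeConjecture.HodgeConjecture.Theorems.Ring2AtlasCMSixfoldsNonVacuity
import Literature.AlgebraicGeometry.Milne1999.CMTypeSimpleIsogenyFactors
import Mathlib.NumberTheory.NumberField.Cyclotomic.Basic
import Mathlib.RingTheory.PowerBasis
import Mathlib.LinearAlgebra.FiniteDimensional.Lemmas
import HarnessLib

set_option linter.dupNamespace false

/-!
# Ring 2 · atlas-2 — the NONDEGENERATE simple CM sixfold cell is NOT VACUOUS (given the realisation record)

HONEST FRAMING: research route conditional on HC_CM; not a corollary; Q11.4-sentence-2 already refuted in dim ≥ 3.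

Cell `pub-hodge-ring2`, seat `pub-hodge-ring2-atlas-2` (generation 49). Companion of `Ring2AtlasCMSixfolds`
(generation 2: the row `g = 6`, simple, CM-type, split by excluded middle into the OPEN degenerate cell
`HodgeDegenerateCMSixfold := HCOnClass (IsSimpleCMSixfold ∧ HasBalancedQuadraticEndomorphism)` and the
KNOWN-IN-PRINT nondegenerate cell `HodgeNondegenerateCMSixfold := HCOnClass (IsSimpleCMSixfold ∧
¬ HasBalancedQuadraticEndomorphism)`) and of `Ring2AtlasCMSixfoldsNonVacuity` (generation 45: the row's class
is inhabited by any realisation of Shimura's primitive cyclotomic CM type `(ℚ(ζ₁₃); {φ₁, …, φ₆})`,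
`Cyclotomic13.Φ`). This file places that witness in its CELL: it has NO endomorphism `φ` with `φ ∘ φ = -d`,
`d > 0`, of any eigenvalue multiplicity, so it inhabits the class of the nondegenerate cell:

* `exists_isSimpleCMSixfold_not_hasBalancedQuadraticEndomorphism_of_cmAbelianVarietyRealised :
    PicardCM.CMAbelianVarietyRealised → ∃ A, IsSimpleCMSixfold A ∧ ¬ HasBalancedQuadraticEndomorphism A`,
* `hodgeNondegenerateCMSixfold_class_nonempty` (the same, as nonemptiness of the cell's class).

The hypothesis `PicardCM.CMAbelianVarietyRealised` (Shimura 1998 §6.2 Thm. 3, the cell's standing realisation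
record `(h₃)`) is an explicit ARGUMENT, never an axiom; `HC_CM` is not involved.

## Proof: `End⁰(A) = ℚ(ζ₁₃)`, which has no imaginary quadratic element

(1) `exists_algEquiv_endAlgebra_of_isCMTypeRealisation`: for every realisation `(A, ι, θ)` of
`(ℚ(ζ₁₃); Φ)` the `ℚ`-algebra map `ℚ(ζ₁₃) → End⁰(A)`, `ζ ↦ ι(ζ)` (`PowerBasis.lift` on the power basis
`1, ζ, …, ζ¹¹`; `ι(ζ)` is a root of `Φ₁₃` in `End⁰(A)`) is an ISOMORPHISM: `A` is simple (primitivity,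
`isSimple_of_isCMTypeRealisation_of_primitive`, Shimura §8.2 Prop. 26) and of CM-type, so by the tree's
`Milne1999.IsOfCMType.isOfCMTypeSimple` (Shimura §5.1 Props. 3, 4, 6: in characteristic `0` a simple abelian
variety whose `End⁰` contains a field of degree `2 dim` has `End⁰` equal to that field; Milne 1999 §2 p. 54)
`End⁰(A)` is a field of `ℚ`-dimension `2 · 6 = 12 = [ℚ(ζ₁₃) : ℚ]`; a ring map out of a field is injective,
and injective + equal finite dimension (`AbelianVariety.finiteDimensional_endAlgebra_holds`, Mumford §19
Cor. 1–2 of Thm. 3) = bijective. This is Shimura's «the commutor of `F` in `End_ℚ(A)`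
coincides with `F`» [§5.1 Prop. 3] and «`End_ℚ(B) = K`» [Prop. 6] for this `A`.

(2) `Cyclotomic13.sq_ne_neg_natCast`: no `α ∈ ℚ(ζ₁₃)` has `α² = -d` with `d ∈ ℕ`, `d > 0` — the Galois
group `(ℤ/13)^× = ⟨2⟩` is cyclic, so its unique index-2 subgroup `⟨4⟩` contains complex conjugation
`-1 = 2⁶`: with `g : ζ ↦ ζ²` (`exists_ringHom_apply_ζ_eq_ζ_sq`), `(gα)² = α²` gives `gα = ±α`, so `g²α = α`,
so `g⁶α = α`; under the embedding `s : ζ ↦ e^{2πi/13}` one has `s ∘ g⁶ = conj ∘ s` (`2⁶ = 64 ≡ -1 mod 13`),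
so `s(α)` is REAL and `s(α)² = -d < 0` is absurd. (Equivalently: the quadratic subfield of `ℚ(ζ₁₃)` is the
real field `ℚ(√13)`.)

(3) Hence `φ ≫ φ = -(d • 𝟙 A)` with `d > 0` is impossible for ANY `φ : A → A`
(`comp_self_ne_neg_nsmul_one_of_isCMTypeRealisation`: transport `φ` to `α = e⁻¹(φ) ∈ ℚ(ζ₁₃)` with
`α² = -d`), in particular `¬ HasBalancedQuadraticEndomorphism A` (the multiplicity-`3` clause is not even
needed), while `IsSimpleCMSixfold A` is generation 45's theorem.

WHAT THIS IS NOT: no cell `def`, KIND, row word or count of `Ring2AtlasCMSixfolds` changes; nothing is said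
about the OPEN degenerate cell (inhabiting `IsSimpleCMSixfold ∧ HasBalancedQuadraticEndomorphism` needs a CM
field WITH a balanced imaginary quadratic subfield and an eigenvalue-multiplicity computation on `H^{1,0}`, not
attempted); no Hodge class is computed and no `HC` word is claimed for the witness (non-vacuity only).

References: [Shimura1998] G. Shimura, *Abelian Varieties with Complex Multiplication and Modular Functions*,
Princeton (1998), §5.1 Props. 3, 4, 6, §8.2 Prop. 26, §8.4 Example (1), §6.2 Thm. 3; [Milne1999] J. S. Milne,
*Lefschetz motives and the Tate conjecture*, Compositio Math. 117 (1999), §2 p. 54.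
-/

noncomputable section

open Polynomial NumberField CategoryTheory

namespace Summit.HodgeConjecture.HodgeConjecture.Ring2.Atlas

open Literature.AlgebraicGeometry Literature.AlgebraicGeometry.Motives
open Literature.AlgebraicGeometry.HodgeTheory (complexBetti)
open Literature.AlgebraicGeometry.ComplexMultiplication
open Literature.NumberTheory.ComplexMultiplication
open Literature.NumberTheory.Automorphic (PicardCM.CMAbelianVarietyRealised)
open Literature.AlgebraicGeometry.Milne1999 (IsOfCMType IsOfCMTypeSimple)

namespace Cyclotomic13

/-- The automorphism `ζ ↦ ζ²` of `ℚ(ζ₁₃)` (a generator of `Gal(ℚ(ζ₁₃)/ℚ) ≅ (ℤ/13)^×`, `2` being a primitive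
root mod `13`), as a ring endomorphism (embeddings of a cyclotomic field ↔ primitive roots, Mathlib's
`IsPrimitiveRoot.embeddingsEquivPrimitiveRoots`). [folklore] -/
theorem exists_ringHom_apply_ζ_eq_ζ_sq : ∃ g : K13 →+* K13, g ζ = ζ ^ 2 := by
  have hirr : Irreducible (cyclotomic 13 ℚ) := cyclotomic.irreducible_rat (by norm_num)
  have hmem : ζ ^ 2 ∈ primitiveRoots 13 K13 :=
    (mem_primitiveRoots (by norm_num)).2 (isPrimitiveRoot_ζ.pow_of_coprime 2 (by norm_num))
  refine ⟨((isPrimitiveRoot_ζ.embeddingsEquivPrimitiveRoots K13 hirr).symm ⟨ζ ^ 2, hmem⟩).toRingHom, ?_⟩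
  have h := isPrimitiveRoot_ζ.embeddingsEquivPrimitiveRoots_apply_coe K13 hirr
    ((isPrimitiveRoot_ζ.embeddingsEquivPrimitiveRoots K13 hirr).symm ⟨ζ ^ 2, hmem⟩)
  rw [Equiv.apply_symm_apply] at h
  exact h.symm

/-- **`ℚ(ζ₁₃)` contains no square root of a negative rational integer**: `α² ≠ -d` for `α ∈ ℚ(ζ₁₃)`,
`d ∈ ℕ`, `d > 0` (the Galois group is cyclic of order `12`, so the quadratic subfield is unique, and it is
the real field `ℚ(√13)`; here: `g : ζ ↦ ζ²` has `gα = ±α`, so `g⁶ = ` complex conjugation fixes `α`, so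
`α` is real under `ζ ↦ e^{2πi/13}`, and a real number has nonnegative square). [folklore] -/
theorem sq_ne_neg_natCast (α : K13) {d : ℕ} (hd : 0 < d) : α ^ 2 ≠ -(d : K13) := by
  intro hα
  obtain ⟨g, hg⟩ := exists_ringHom_apply_ζ_eq_ζ_sq
  have hgα : g (g α) = α := by
    have h1 : (g α) ^ 2 = α ^ 2 := by rw [← map_pow, hα, map_neg, map_natCast]
    rcases sq_eq_sq_iff_eq_or_eq_neg.1 h1 with h | h
    · rw [h, h]
    · rw [h, map_neg, h, neg_neg]
  have h13 : ζ ^ 13 = 1 := isPrimitiveRoot_ζ.pow_eq_one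
  -- `g⁶` fixes `α` and sends `ζ` to `ζ^64 = ζ^12 = ζ⁻¹`
  have hg6α : g (g (g (g (g (g α))))) = α := by rw [hgα, hgα, hgα]
  have hg6ζ : g (g (g (g (g (g ζ))))) = ζ ^ 12 := by
    simp only [hg, map_pow, ← pow_mul]
    calc ζ ^ (2 * 2 * 2 * 2 * 2 * 2) = (ζ ^ 13) ^ 4 * ζ ^ 12 := by ring
      _ = ζ ^ 12 := by rw [h13, one_pow, one_mul]
  -- the embedding `ζ ↦ μ`; `s ∘ g⁶ = conj ∘ s`
  obtain ⟨s, hs⟩ := exists_embedding_apply_ζ_eq (c := 1) (by norm_num)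
  rw [pow_one] at hs
  let g6 : K13 →+* K13 := ((((g.comp g).comp g).comp g).comp g).comp g
  have hconj : s.comp g6 = (starRingEnd ℂ).comp s := by
    apply ringHom_ext_ζ
    simp only [g6, RingHom.comp_apply, hg6ζ, map_pow, hs, conj_μ]
  have hfix : starRingEnd ℂ (s α) = s α := by
    have h := congrArg (fun t : K13 →+* ℂ ↦ t α) hconj
    simp only [g6, RingHom.comp_apply, hg6α] at h
    exact h.symm
  have him : (s α).im = 0 := Complex.conj_eq_iff_im.1 hfix
  have hsq : (s α) ^ 2 = -(d : ℂ) := by rw [← map_pow, hα, map_neg, map_natCast]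
  have hre : (s α).re * (s α).re = -(d : ℝ) := by
    have h := congrArg Complex.re hsq
    rw [sq, Complex.mul_re, him, mul_zero, sub_zero, Complex.neg_re, Complex.natCast_re] at h
    exact h
  have hd' : (0 : ℝ) < d := Nat.cast_pos.2 hd
  nlinarith [mul_self_nonneg (s α).re]

end Cyclotomic13

open Cyclotomic13

variable {A : AbelianVariety ℂ} {ι : 𝓞 K13 →+* End A} {θ : K13 →+* Module.End ℂ (complexBetti A.X 1)}

/-- **`End⁰(A) = ℚ(ζ₁₃)` for every realisation `(A, ι, θ)` of Shimura's primitive type `(ℚ(ζ₁₃); Φ)`.**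
The `ℚ`-algebra map `ℚ(ζ₁₃) → End⁰(A)`, `ζ ↦ ι(ζ)` (`PowerBasis.lift` on the power basis `1, ζ, …, ζ¹¹`
at the root `ι(ζ)` of `Φ₁₃`), is an isomorphism: `A` is simple (Shimura §8.2 Prop. 26, the tree's
`isSimple_of_isCMTypeRealisation_of_primitive` with `Cyclotomic13.Φ_primitive`) and of CM-type, so
`End⁰(A)` is a field of degree `2 dim A = 12` (`Milne1999.IsOfCMType.isOfCMTypeSimple`; Shimura §5.1
Props. 3, 4, 6: «the commutor of `F` in `End_ℚ(A)` coincides with `F`», «`End_ℚ(B) = K`»); a ring map out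
of the field `ℚ(ζ₁₃)` is injective, hence bijective by the dimension count `12 = 12` (`End⁰(A)` is
finite-dimensional, `AbelianVariety.finiteDimensional_endAlgebra_holds`, Mumford §19 Cor. 1–2 of Thm. 3).
[cite: Shimura1998, §5.1 Props. 3, 4, 6 and §8.2 Prop. 26] [cite: Milne1999, §2 p. 54] -/
theorem exists_algEquiv_endAlgebra_of_isCMTypeRealisation (hA : IsCMTypeRealisation Φ A ι θ) :
    ∃ e : K13 ≃ₐ[ℚ] A.endAlgebra, e ζ = AbelianVariety.endAlgebra.of A (ι isPrimitiveRoot_ζ.toInteger) := by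
  have hS : A.IsSimple := isSimple_of_isCMTypeRealisation_of_primitive hA Φ_primitive
  have hCM : IsOfCMType A := isOfCMType_of_isCMTypeRealisation hA
  have hdim' : A.dim = Module.finrank ℚ K13 / 2 := Motives.schemeDim_eq_holds hA.1
  have hdim : A.dim = 6 := by rw [hdim', finrank_K13]
  obtain ⟨hF, hrk⟩ := hCM.isOfCMTypeSimple hS (by rw [hdim]; norm_num)
  have hrk12 : Module.finrank ℚ A.endAlgebra = 12 := by rw [hdim] at hrk; exact hrk
  haveI : Nontrivial A.endAlgebra := ⟨hF.exists_pair_ne⟩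
  have hfin : Module.Finite ℚ A.endAlgebra := AbelianVariety.finiteDimensional_endAlgebra_holds A
  -- `ι(ζ)` is a root of `Φ₁₃ = minpoly_ℚ ζ` in `End⁰(A)` (`ζ` as an algebraic integer: `IsPrimitiveRoot.toInteger`)
  let ρ : 𝓞 K13 →+* A.endAlgebra := (AbelianVariety.endAlgebra.of A).comp ι
  let ζInt : 𝓞 K13 := isPrimitiveRoot_ζ.toInteger
  have hroot : (cyclotomic 13 (𝓞 K13)).eval ζInt = 0 :=
    isPrimitiveRoot_ζ.toInteger_isPrimitiveRoot.isRoot_cyclotomic (by norm_num)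
  have hf : aeval (ρ ζInt) (minpoly ℚ (isPrimitiveRoot_ζ.powerBasis ℚ).gen) = 0 := by
    rw [IsPrimitiveRoot.powerBasis_gen, ← cyclotomic_eq_minpoly_rat isPrimitiveRoot_ζ (by norm_num),
      aeval_def, ← Polynomial.eval_map, Polynomial.map_cyclotomic, ← Polynomial.map_cyclotomic 13 ρ,
      Polynomial.eval_map, Polynomial.eval₂_hom, hroot, map_zero]
  -- the lift `ψ : ℚ(ζ₁₃) →ₐ[ℚ] End⁰(A)`, `ζ ↦ ι(ζ)`; injective, hence surjective by `12 = 12`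
  let ψ : K13 →ₐ[ℚ] A.endAlgebra := (isPrimitiveRoot_ζ.powerBasis ℚ).lift (ρ ζInt) hf
  have hψζ : ψ ζ = ρ ζInt := by
    have h := (isPrimitiveRoot_ζ.powerBasis ℚ).lift_gen (ρ ζInt) hf
    rwa [IsPrimitiveRoot.powerBasis_gen] at h
  have hinj : Function.Injective ψ := ψ.toRingHom.injective
  have H : Module.finrank ℚ K13 = Module.finrank ℚ A.endAlgebra := finrank_K13.trans hrk12.symm
  -- (`Module ℚ End⁰(A)` is found only through `Algebra ℚ End⁰(A)`: instances passed explicitly)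
  have hsurj : Function.Surjective ψ :=
    (@LinearMap.injective_iff_surjective_of_finrank_eq_finrank ℚ K13 _ _ _ A.endAlgebra _
      Algebra.toModule _ hfin H ψ.toLinearMap).1 hinj
  exact ⟨AlgEquiv.ofBijective ψ ⟨hinj, hsurj⟩, hψζ⟩

/-- **No endomorphism of square `-d`.** For a realisation `A` of `(ℚ(ζ₁₃); Φ)` and any `φ : A → A`, `d > 0`:
`φ ∘ φ ≠ -d`. Transport `φ` through `End(A) → End⁰(A) ≅ ℚ(ζ₁₃)`
(`exists_algEquiv_endAlgebra_of_isCMTypeRealisation`) to `α ∈ ℚ(ζ₁₃)` with `α² = -d`, excluded by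
`Cyclotomic13.sq_ne_neg_natCast`. [folklore] -/
theorem comp_self_ne_neg_nsmul_one_of_isCMTypeRealisation (hA : IsCMTypeRealisation Φ A ι θ)
    (φ : A ⟶ A) {d : ℕ} (hd : 0 < d) : φ ≫ φ ≠ -(d • 𝟙 A) := by
  intro hφ
  obtain ⟨e, -⟩ := exists_algEquiv_endAlgebra_of_isCMTypeRealisation hA
  have h1 : End.of φ * End.of φ = -(d • (1 : End A)) := by
    change End.of (φ ≫ φ) = End.of (-(d • 𝟙 A))
    rw [hφ]
  have hxx : (AbelianVariety.endAlgebra.of A (End.of φ)) ^ 2 = -(d : A.endAlgebra) := by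
    rw [sq, ← map_mul, h1, map_neg, map_nsmul, map_one, nsmul_eq_mul, mul_one]
  have hα : (e.symm (AbelianVariety.endAlgebra.of A (End.of φ))) ^ 2 = -(d : K13) := by
    apply e.injective
    rw [map_pow, AlgEquiv.apply_symm_apply, hxx, map_neg, map_natCast]
  exact sq_ne_neg_natCast _ hd hα

/-- Hence a realisation of `(ℚ(ζ₁₃); Φ)` carries NO balanced imaginary quadratic endomorphism (it carries no
`φ` with `φ ∘ φ = -d < 0` at all, whatever the eigenvalue multiplicity): it lies in the class of the
NONDEGENERATE cell `¬ HasBalancedQuadraticEndomorphism` of the simple CM sixfold row (as that cell is DEFINED;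
nothing is claimed about Mumford–Tate ranks, which are not a typed notion). [folklore] -/
theorem not_hasBalancedQuadraticEndomorphism_of_isCMTypeRealisation (hA : IsCMTypeRealisation Φ A ι θ) :
    ¬ HasBalancedQuadraticEndomorphism A := by
  rintro ⟨φ, d, hd, hφ, -⟩
  exact comp_self_ne_neg_nsmul_one_of_isCMTypeRealisation hA φ hd hφ

/-- **NON-VACUITY OF THE NONDEGENERATE CELL of the row `g = 6`, simple, CM-type.** Given the realisation record
for CM abelian varieties (`PicardCM.CMAbelianVarietyRealised`, Shimura 1998 §6.2 Thm. 3, an explicit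
hypothesis), there is a complex abelian variety `A` with `IsSimpleCMSixfold A` (generation 45:
`A.dim = 6`, simple by primitivity, of CM-type) and `¬ HasBalancedQuadraticEndomorphism A` (this file:
`End⁰(A) = ℚ(ζ₁₃)` has no element of square `-d < 0`) — namely any realisation of Shimura's primitive
cyclotomic CM type `(ℚ(ζ₁₃); {φ₁, …, φ₆})`. [cite: Shimura1998, §8.4 Example (1), p. 64; §8.2 Prop. 26, p. 61; §5.1 Props. 3, 4, 6; §6.2 Thm. 3] -/
theorem exists_isSimpleCMSixfold_not_hasBalancedQuadraticEndomorphism_of_cmAbelianVarietyRealised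
    (h₃ : PicardCM.CMAbelianVarietyRealised) :
    ∃ A : AbelianVariety ℂ, IsSimpleCMSixfold A ∧ ¬ HasBalancedQuadraticEndomorphism A := by
  obtain ⟨A, ι, θ, hA⟩ := h₃ K13 Φ
  have hA' : IsCMTypeRealisation Φ A ι θ := hA
  have hdim : A.dim = Module.finrank ℚ K13 / 2 := Motives.schemeDim_eq_holds hA'.1
  refine ⟨A, ⟨?_, isSimple_of_isCMTypeRealisation_of_primitive hA' Φ_primitive,
    isOfCMType_of_isCMTypeRealisation hA'⟩, not_hasBalancedQuadraticEndomorphism_of_isCMTypeRealisation hA'⟩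
  rw [hdim, finrank_K13]

/-- Hence the class of the cell target `HodgeNondegenerateCMSixfold = HCOnClass (IsSimpleCMSixfold ∧
¬ HasBalancedQuadraticEndomorphism)` is nonempty: the known-in-print cell is not vacuously true either.
[folklore] -/
theorem hodgeNondegenerateCMSixfold_class_nonempty (h₃ : PicardCM.CMAbelianVarietyRealised) :
    {A : AbelianVariety ℂ | IsSimpleCMSixfold A ∧ ¬ HasBalancedQuadraticEndomorphism A}.Nonempty :=
  exists_isSimpleCMSixfold_not_hasBalancedQuadraticEndomorphism_of_cmAbelianVarietyRealised h₃

end Summit.HodgeConjecture.HodgeConjecture.Ring2.Atlas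

end
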